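import Literature.MathematicalPhysics.KineticTheory.OneSphereHopfProperty

/-!
# Negative lane of crux `SpecularDiceHopf` (1/2): an explicit two-sphere hard-sphere trajectory

Route `AnosovDiceHopf`, crux `SpecularDiceHopf` (stmt-AtomisticToContinuum-13414; conclusion
`InfiniteHardSphereFlow.HasOneSphereHopfProperty`, definition request D4). Refuter small-model material
(`--supports`, no positive route statement is asserted): two unit spheres `p₀ = (-u, u)`, `q₀ = (u, -u)`
colliding head-on at time `1/2` with the velocities exchanged by the elastic law; the explicit paths
`γp`, `γq`, the tracking map `trajFn`, the configurations `ω₀ = {p₀, q₀}` and `ωt t`, measurability of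
the singleton `{ω₀}` for the count σ-algebra, the collision bookkeeping (the only collision event is at
time `1/2`) and the head-on reflection identities. Part 2 (`HopfPropertyTeeth`) builds the flow
`Φ₀ : InfiniteHardSphereFlow (Fin 3) 1` from this and shows that property (H) FAILS for `(Φ₀, δ_{ω₀})`.
-/

noncomputable section

open MeasureTheory ProbabilityTheory Set Filter Function Metric
open scoped ENNReal Topology InnerProductSpace RealInnerProductSpace
open Literature.Analysis.FunctionSpaces Literature.Analysis.FluidPDE
open Literature.MathematicalPhysics.KineticTheory

namespace Summit.AtomisticToContinuum.HydrodynamicLimit.Theorems.SpecularDiceHopf.Negative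

local notation "E³" => EuclideanSpace ℝ (Fin 3)
local notation "E²" => EuclideanSpace ℝ (Fin 2)


/-! ## The unit vector and the two particles -/

/-- The unit vector `u = (1, 0, 0)`. -/
def u : E³ := PiLp.single 2 (0 : Fin 3) (1 : ℝ)

/-- `u` is a unit vector. -/
theorem norm_u : ‖u‖ = 1 := by
  rw [u, PiLp.norm_single, norm_one]

/-- `u ≠ 0`. -/
theorem u_ne_zero : u ≠ 0 := by
  intro h
  have h1 := norm_u
  rw [h, norm_zero] at h1
  exact zero_ne_one h1

/-- `⟪u, u⟫ = 1`. -/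
theorem inner_u_u : ⟪u, u⟫_ℝ = 1 := by
  rw [real_inner_self_eq_norm_sq, norm_u, one_pow]

/-- `‖c • u‖ = |c|`. -/
theorem norm_smul_u (c : ℝ) : ‖c • u‖ = |c| := by
  rw [norm_smul, norm_u, mul_one, Real.norm_eq_abs]

/-- Scalar multiples of `u` determine the scalar. -/
theorem smul_u_inj {a b : ℝ} (h : a • u = b • u) : a = b :=
  (smul_left_inj u_ne_zero).1 h

/-- `u ≠ -u`. -/
theorem u_ne_neg_u : u ≠ -u := by
  intro h
  have h1 : (1 : ℝ) • u = (-1 : ℝ) • u := by rw [one_smul, neg_one_smul]; exact h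
  have h2 := smul_u_inj h1
  norm_num at h2

/-- Particle `p₀`: at `-u` with velocity `u`. -/
def p₀ : E³ × E³ := (-u, u)

/-- Particle `q₀`: at `u` with velocity `-u`. -/
def q₀ : E³ × E³ := (u, -u)

/-- The two particles are distinct phase points. -/
theorem p₀_ne_q₀ : p₀ ≠ q₀ := fun h => u_ne_neg_u (congrArg Prod.snd h)

/-! ## The explicit trajectories (head-on collision at time `1/2`, velocities exchanged) -/

/-- Path of `p₀`. -/
def γp (t : ℝ) : E³ × E³ := if 2⁻¹ ≤ t then (-(t • u), -u) else (-u + t • u, u)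

/-- Path of `q₀`. -/
def γq (t : ℝ) : E³ × E³ := if 2⁻¹ ≤ t then (t • u, u) else (u - t • u, -u)

open Classical in
/-- The particle-tracking map (free flight for any other label: junk). -/
def trajFn (r : E³ × E³) (t : ℝ) : E³ × E³ :=
  if r = p₀ then γp t else if r = q₀ then γq t else (r.1 + t • r.2, r.2)

/-- Tracking of `p₀` is the path `γp`. -/
@[simp] theorem trajFn_p₀ (t : ℝ) : trajFn p₀ t = γp t := by simp [trajFn]

/-- Tracking of `q₀` is the path `γq`. -/
@[simp] theorem trajFn_q₀ (t : ℝ) : trajFn q₀ t = γq t := by simp [trajFn, p₀_ne_q₀.symm]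

/-- `γp` starts at `p₀`. -/
theorem γp_zero : γp 0 = p₀ := by
  unfold γp p₀
  rw [if_neg (by norm_num)]
  simp

/-- `γq` starts at `q₀`. -/
theorem γq_zero : γq 0 = q₀ := by
  unfold γq q₀
  rw [if_neg (by norm_num)]
  simp

/-- The relative position `x_p - x_q` along the two paths. -/
theorem fst_sub (t : ℝ) :
    (γp t).1 - (γq t).1 = (if 2⁻¹ ≤ t then -(2 * t) else 2 * t - 2) • u := by
  unfold γp γq
  split_ifs with h <;> dsimp only <;> module

/-- The relative position `x_q - x_p` along the two paths. -/
theorem fst_sub' (t : ℝ) :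
    (γq t).1 - (γp t).1 = (if 2⁻¹ ≤ t then 2 * t else 2 - 2 * t) • u := by
  rw [← neg_sub, fst_sub, ← neg_smul]
  congr 1
  split_ifs <;> ring

/-- The distance of the two centres: `2t` after the collision, `2 - 2t` before. -/
theorem norm_fst_sub (t : ℝ) : ‖(γp t).1 - (γq t).1‖ = if 2⁻¹ ≤ t then 2 * t else 2 - 2 * t := by
  rw [fst_sub, norm_smul_u]
  split_ifs with h
  · rw [abs_neg, abs_of_nonneg (by linarith)]
  · rw [abs_of_neg (by linarith)]
    ring

/-- Hard core: the centres stay at distance `≥ 1`. -/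
theorem one_le_norm_fst_sub (t : ℝ) : 1 ≤ ‖(γp t).1 - (γq t).1‖ := by
  rw [norm_fst_sub]
  split_ifs with h <;> linarith

/-- Contact happens exactly at time `1/2`. -/
theorem norm_fst_sub_eq_one_iff (t : ℝ) : ‖(γp t).1 - (γq t).1‖ = 1 ↔ t = 2⁻¹ := by
  rw [norm_fst_sub]
  split_ifs with h
  · constructor <;> intro h' <;> linarith
  · constructor <;> intro h' <;> linarith

/-! ## The configuration, counting and measurability of `{ω₀}` -/

/-- The label set `{p₀, q₀}`. -/
def S₀ : Set (E³ × E³) := {p₀, q₀}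

/-- Membership in the label set. -/
theorem mem_S₀ {r : E³ × E³} : r ∈ S₀ ↔ r = p₀ ∨ r = q₀ := by
  simp only [S₀, mem_insert_iff, mem_singleton_iff]

/-- The label set is finite. -/
theorem S₀_finite : S₀.Finite := (Set.finite_singleton q₀).insert p₀

/-- A finite set of phase points as a (locally finite) configuration. -/
def conf (s : Set (E³ × E³)) (hs : s.Finite) : PointConfig (E³ × E³) :=
  ⟨s, fun _ _ => hs.subset inter_subset_left⟩

/-- The initial configuration `ω₀ = {p₀, q₀}`. -/
def ω₀ : PointConfig (E³ × E³) := conf S₀ S₀_finite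

/-- The configuration at time `t`. -/
def ωt (t : ℝ) : PointConfig (E³ × E³) := conf {γp t, γq t} ((Set.finite_singleton _).insert _)

/-- The carrier of `ω₀` is the label set. -/
theorem coe_ω₀ : ((ω₀ : PointConfig (E³ × E³)) : Set (E³ × E³)) = S₀ := rfl

/-- Membership in `ω₀`. -/
theorem mem_ω₀ {r : E³ × E³} : r ∈ ω₀ ↔ r = p₀ ∨ r = q₀ := by
  show r ∈ S₀ ↔ _
  exact mem_S₀

/-- Membership in `ωt t`. -/
theorem mem_ωt {t : ℝ} {r : E³ × E³} : r ∈ ωt t ↔ r = γp t ∨ r = γq t := by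
  show r ∈ ({γp t, γq t} : Set (E³ × E³)) ↔ _
  simp only [mem_insert_iff, mem_singleton_iff]

/-- At time `0` the evolved configuration is `ω₀`. -/
theorem ωt_zero : ωt 0 = ω₀ := by
  apply PointConfig.ext
  intro r
  rw [mem_ωt, mem_ω₀, γp_zero, γq_zero]

/-- The orbit returns to `ω₀` only at time `0` (velocities are exchanged at the collision). -/
theorem t_eq_zero_of_ωt_eq {t : ℝ} (h : ωt t = ω₀) : t = 0 := by
  have hp : γp t ∈ ωt t := mem_ωt.2 (Or.inl rfl)
  rw [h, mem_ω₀] at hp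
  rcases hp with h1 | h1
  · unfold γp at h1
    split_ifs at h1 with ht
    · have h2 : -u = u := congrArg Prod.snd h1
      exact absurd h2.symm u_ne_neg_u
    · have h2 : -u + t • u = -u := congrArg Prod.fst h1
      have h3 : t • u = (0 : ℝ) • u := by
        rw [zero_smul]
        exact add_left_cancel (a := -u) (by rw [add_zero]; exact h2)
      exact smul_u_inj h3
  · unfold γp at h1
    split_ifs at h1 with ht
    · have h2 : -(t • u) = u := congrArg Prod.fst h1
      have h3 : (-t) • u = (1 : ℝ) • u := by rw [neg_smul, one_smul]; exact h2
      have h4 := smul_u_inj h3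
      linarith
    · have h2 : u = -u := congrArg Prod.snd h1
      exact absurd h2 u_ne_neg_u

/-- Unfolding of the counting variable. -/
theorem count_eq (ω : PointConfig (E³ × E³)) (s : Set (E³ × E³)) :
    ω.count s = ((ω : Set (E³ × E³)) ∩ s).encard := rfl

/-- `ω₀` has one point at `p₀`. -/
theorem count_ω₀_p₀ : ω₀.count {p₀} = 1 := by
  rw [count_eq, coe_ω₀, inter_eq_right.2 (singleton_subset_iff.2 (mem_S₀.2 (Or.inl rfl))),
    encard_singleton]

/-- `ω₀` has one point at `q₀`. -/
theorem count_ω₀_q₀ : ω₀.count {q₀} = 1 := by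
  rw [count_eq, coe_ω₀, inter_eq_right.2 (singleton_subset_iff.2 (mem_S₀.2 (Or.inr rfl))),
    encard_singleton]

/-- `ω₀` has no point off the label set. -/
theorem count_ω₀_compl : ω₀.count S₀ᶜ = 0 := by
  rw [count_eq, coe_ω₀, inter_compl_self, encard_empty]

/-- A configuration counting one point at `r` contains `r`. -/
theorem mem_of_count_singleton {ω : PointConfig (E³ × E³)} {r : E³ × E³} (h : ω.count {r} = 1) :
    r ∈ ω := by
  have hne : ((ω : Set (E³ × E³)) ∩ {r}).Nonempty := by
    rw [← Set.encard_pos, ← count_eq, h]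
    exact one_pos
  obtain ⟨x, hx, hxr⟩ := hne
  rw [mem_singleton_iff] at hxr
  subst hxr
  exact hx

/-- The singleton `{ω₀}` is measurable for the count σ-algebra (three counting constraints pin it). -/
theorem measurableSet_ω₀ : MeasurableSet ({ω₀} : Set (PointConfig (E³ × E³))) := by
  have hp : MeasurableSet ({p₀} : Set (E³ × E³)) := measurableSet_singleton _
  have hq : MeasurableSet ({q₀} : Set (E³ × E³)) := measurableSet_singleton _
  have hS : MeasurableSet S₀ := hq.insert p₀
  have heq : ({ω₀} : Set (PointConfig (E³ × E³))) =
      (fun ω : PointConfig (E³ × E³) => ω.count {p₀}) ⁻¹' {1} ∩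
        ((fun ω : PointConfig (E³ × E³) => ω.count {q₀}) ⁻¹' {1} ∩
          (fun ω : PointConfig (E³ × E³) => ω.count S₀ᶜ) ⁻¹' {0}) := by
    ext ω
    simp only [mem_singleton_iff, mem_inter_iff, mem_preimage]
    constructor
    · rintro rfl
      exact ⟨count_ω₀_p₀, count_ω₀_q₀, count_ω₀_compl⟩
    · rintro ⟨h1, h2, h3⟩
      have hp₀ : p₀ ∈ ω := mem_of_count_singleton h1
      have hq₀ : q₀ ∈ ω := mem_of_count_singleton h2
      rw [count_eq, Set.encard_eq_zero] at h3
      apply PointConfig.ext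
      intro r
      constructor
      · intro hr
        rw [mem_ω₀, ← mem_S₀]
        by_contra hrS
        have : r ∈ (ω : Set (E³ × E³)) ∩ S₀ᶜ := ⟨hr, hrS⟩
        rw [h3] at this
        exact this
      · intro hr
        rcases mem_ω₀.1 hr with rfl | rfl
        exacts [hp₀, hq₀]
  rw [heq]
  exact (PointConfig.measurable_count hp (measurableSet_singleton 1)).inter
    ((PointConfig.measurable_count hq (measurableSet_singleton 1)).inter
      (PointConfig.measurable_count hS.compl (measurableSet_singleton 0)))

/-- `ω₀` is a hard-sphere configuration for diameter `1`. -/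
theorem isHardCore_ω₀ : IsHardCore 1 ω₀ := by
  intro p hp q hq hpq
  rcases mem_ω₀.1 hp with rfl | rfl <;> rcases mem_ω₀.1 hq with rfl | rfl
  · exact absurd rfl hpq
  · show (1 : ℝ) ≤ ‖-u - u‖
    rw [show -u - u = (-2 : ℝ) • u by module, norm_smul_u]
    norm_num
  · show (1 : ℝ) ≤ ‖u - -u‖
    rw [show u - -u = (2 : ℝ) • u by module, norm_smul_u]
    norm_num
  · exact absurd rfl hpq

/-! ## Collision bookkeeping -/

/-- `p₀` collides at time `1/2`. -/
theorem mem_collisionEvents_p₀ : (p₀, (2⁻¹ : ℝ)) ∈ collisionEvents 1 S₀ trajFn :=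
  ⟨mem_S₀.2 (Or.inl rfl), q₀, mem_S₀.2 (Or.inr rfl), p₀_ne_q₀.symm, by
    show ‖(trajFn p₀ 2⁻¹).1 - (trajFn q₀ 2⁻¹).1‖ = 1
    rw [trajFn_p₀, trajFn_q₀, norm_fst_sub_eq_one_iff]⟩

/-- `q₀` collides at time `1/2`. -/
theorem mem_collisionEvents_q₀ : (q₀, (2⁻¹ : ℝ)) ∈ collisionEvents 1 S₀ trajFn :=
  ⟨mem_S₀.2 (Or.inr rfl), p₀, mem_S₀.2 (Or.inl rfl), p₀_ne_q₀, by
    show ‖(trajFn q₀ 2⁻¹).1 - (trajFn p₀ 2⁻¹).1‖ = 1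
    rw [trajFn_p₀, trajFn_q₀, norm_sub_rev, norm_fst_sub_eq_one_iff]⟩

/-- The only collision events are `(p₀, 1/2)` and `(q₀, 1/2)`. -/
theorem collisionEvents_subset :
    collisionEvents 1 S₀ trajFn ⊆ {(p₀, (2⁻¹ : ℝ)), (q₀, (2⁻¹ : ℝ))} := by
  rintro ⟨r, t⟩ ⟨hr, q, hq, hqr, hdist⟩
  dsimp only at hr hq hqr hdist
  simp only [mem_insert_iff, mem_singleton_iff, Prod.mk.injEq]
  rcases mem_S₀.1 hr with rfl | rfl <;> rcases mem_S₀.1 hq with rfl | rfl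
  · exact absurd rfl hqr
  · left
    refine ⟨rfl, ?_⟩
    rwa [trajFn_p₀, trajFn_q₀, norm_fst_sub_eq_one_iff] at hdist
  · right
    refine ⟨rfl, ?_⟩
    rwa [trajFn_p₀, trajFn_q₀, norm_sub_rev, norm_fst_sub_eq_one_iff] at hdist
  · exact absurd rfl hqr

/-- The collision times of `p₀` are `{1/2}`. -/
theorem collisionTimes_p₀ : TaggedParticle.collisionTimes 1 S₀ trajFn p₀ = {2⁻¹} := by
  ext t
  rw [TaggedParticle.mem_collisionTimes, mem_singleton_iff]
  constructor
  · rintro ⟨q, hq, hqp, hdist⟩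
    rcases mem_S₀.1 hq with rfl | rfl
    · exact absurd rfl hqp
    · rwa [trajFn_p₀, trajFn_q₀, norm_fst_sub_eq_one_iff] at hdist
  · rintro rfl
    exact ⟨q₀, mem_S₀.2 (Or.inr rfl), p₀_ne_q₀.symm, by
      rw [trajFn_p₀, trajFn_q₀, norm_fst_sub_eq_one_iff]⟩

/-- The collision times of `q₀` are `{1/2}`. -/
theorem collisionTimes_q₀ : TaggedParticle.collisionTimes 1 S₀ trajFn q₀ = {2⁻¹} := by
  ext t
  rw [TaggedParticle.mem_collisionTimes, mem_singleton_iff]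
  constructor
  · rintro ⟨q, hq, hqp, hdist⟩
    rcases mem_S₀.1 hq with rfl | rfl
    · rwa [trajFn_p₀, trajFn_q₀, norm_sub_rev, norm_fst_sub_eq_one_iff] at hdist
    · exact absurd rfl hqp
  · rintro rfl
    exact ⟨p₀, mem_S₀.2 (Or.inl rfl), p₀_ne_q₀, by
      rw [trajFn_p₀, trajFn_q₀, norm_sub_rev, norm_fst_sub_eq_one_iff]⟩

/-- Head-on elastic reflection exchanges the velocities (first form). -/
theorem reflect_head_on₁ (c : ℝ) (hc : c ≠ 0) : (reflectVel (c • u) (u, -u)).1 = -u := by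
  simp only [reflectVel]
  have h1 : ⟪u - -u, c • u⟫_ℝ / ‖c • u‖ ^ 2 = 2 / c := by
    rw [show u - -u = (2 : ℝ) • u by module, real_inner_smul_left, real_inner_smul_right, inner_u_u,
      mul_one, norm_smul_u, sq_abs, sq, mul_div_mul_right _ _ hc]
  rw [h1, smul_smul, div_mul_cancel₀ _ hc]
  module

/-- Head-on elastic reflection exchanges the velocities (second form). -/
theorem reflect_head_on₂ (c : ℝ) (hc : c ≠ 0) : (reflectVel (c • u) (-u, u)).1 = u := by
  simp only [reflectVel]
  have h1 : ⟪-u - u, c • u⟫_ℝ / ‖c • u‖ ^ 2 = -2 / c := by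
    rw [show -u - u = (-2 : ℝ) • u by module, real_inner_smul_left, real_inner_smul_right, inner_u_u,
      mul_one, norm_smul_u, sq_abs, sq, mul_div_mul_right _ _ hc]
  rw [h1, smul_smul, div_mul_cancel₀ _ hc]
  module

end Summit.AtomisticToContinuum.HydrodynamicLimit.Theorems.SpecularDiceHopf.Negative
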